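import Summits.BirchSwinnertonDyer.BirchSwinnertonDyer.Theorems.ManinLocalTwoThreeBlindFamilyTamagawa
import HarnessLib
import HarnessLib.Audit.Tags

/-!
# The blind family's BSD₂ / cusp criterion WITH THE LOCAL TERMS DISCHARGED: `BSD₂(E′_m) ⟺ 2b·L(E′_m,1) = a·Ω`
# and, given BSD₂, `c(D) odd ⟺ v₂([0]⁺_f) = −1` — E-an-102 is now the ONLY named input of an's §65 chain
# (cell `bsd-f2-manin`, crux C2 `ManinOddAtFour` stmt-BirchSwinnertonDyer-22967; an MEMO-an §65 (D)/(D′); C2/C3 LEAD p1 gen 8)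

Summit `BirchSwinnertonDyer`, route `ManinLocalTwoThree`.  an's leaf `BlindFamilyBSDTwo` proved, on the blind family
`E′_m = blindCurve m` (odd `|m| ≥ 3`, `p = m² + 4` prime; rank `0`, `Ш[2] = 0`, `Reg = 1` by the 2-isogeny descent),
the equivalence `BSD₂(E′_m) ⟺ «2b·L*(E′_m) = a·Ω_{E′_m}, a, b odd»` and the CUSP CRITERION `c(D) odd ⟺ {∞,0}_f is a
half-unit multiple of Ω⁺_f` GIVEN the two local terms `#E′_m(ℚ)_tors = 2`, `∏ c_ℓ = 2·c₂` (`c₂` odd) as hypotheses, resp. the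
support row E-an-103 `BlindFamilyLocalTerms`.  Both local terms are now tree theorems (`blindFamilyTorsionLaw_holds` p660428,
`blindFamilyTamagawaLaw_holds` / `blindFamilyLocalTerms_holds` p661375), so this file restates an's edges WITHOUT them:

* `bsdTwoAdicLead_blindCurve_iff_halfUnit` — BSD₂ on the family IS the half-unit `L`-value statement (no law left);
* `blindCurve_maninOdd_iff_cuspHalf_of_bsdTwo'`, `blindCurve_bsdTwo_of_maninOdd_of_cuspHalf'` — per member, given BSD₂(E′_m);
* `blindFamily_maninOdd_iff_ratPlusSymbol'` — family level, Mazur–Tate–Teitelbaum form: under E-an-102 ALONE, for every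
  `X₀`-optimal datum of a member with `L ≠ 0`, `c(D)` is odd iff `v₂([0]⁺_f) = −1`.

What this is NOT: E-an-102 `BlindFamilyBSDTwo` (the 2-part of BSD on the family) stays OPEN; nothing here proves C2 on the
family.  `--supports 22967`.  BSD is not proved by this; Manin's conjecture is not proved by this.

References: [Tate1974] Conj. 4(b); [CremonaAlgorithms1997] §2.8; [MazurTateTeitelbaum1986] §I.8 (the rational plus symbol).
-/

set_option autoImplicit false
-- lint-debt: the directory name repeats the summit name (sibling precedent `ManinLocalTwoThreeBlindFamilyTamagawa.lean`)
set_option linter.dupNamespace false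

noncomputable section

open scoped Classical

open WeierstrassCurve Literature.NumberTheory.EllipticCurves Literature.NumberTheory.EllipticCurves.ModularForms
  Summit.BirchSwinnertonDyer.Rank1Residual.ManinAdditive
  Summit.BirchSwinnertonDyer.Rank1Residual.ManinAdditive.ShimuraLedger
  Summit.BirchSwinnertonDyer.Rank1Residual.ManinAdditive.BlindFamilyDescent

namespace Summit.BirchSwinnertonDyer.BirchSwinnertonDyer.Theorems.ManinLocalTwoThree

/-- `p = m² + 4` as a cast identity. [folklore] -/
theorem natAbs_sq_add_four_cast (m : ℤ) : (((m ^ 2 + 4).natAbs : ℕ) : ℤ) = m ^ 2 + 4 :=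
  Int.natAbs_of_nonneg (by positivity)

/-- The Tamagawa cofactor `c₂ ∈ {3, 1}` is odd. [folklore] -/
theorem not_two_dvd_blindTamagawaCofactor (m : ℤ) : ¬ 2 ∣ (if m % 8 = 1 then 3 else 1 : ℕ) := by
  split <;> decide

/-- **BSD₂ on the blind family IS the half-unit `L`-value statement** (odd `|m| ≥ 3`, `m² + 4` prime, `Ш` finite):
`BSD₂(E′_m) ⟺ ∃ a b odd, 2b·L*(E′_m) = a·Ω_{E′_m}` — an's `blindCurve_bsdTwo_iff_halfUnit` with `#tors = 2` and
`∏ c_ℓ = 2·c₂` DISCHARGED. [cite: Tate1974, Conjecture 4(b)] -/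
theorem bsdTwoAdicLead_blindCurve_iff_halfUnit {m : ℤ} (hm : Odd m) (h3 : 3 ≤ |m|)
    (hp : Nat.Prime (m ^ 2 + 4).natAbs) [Finite (blindCurve m).sha] :
    BSDTwoAdicLead (blindCurve m) ↔
      ∃ a b : ℕ, ¬ 2 ∣ a ∧ ¬ 2 ∣ b ∧
        2 * (b : ℂ) * (blindCurve m).leadingLCoeff = (a : ℂ) * ((blindCurve m).realPeriodRat : ℂ) := by
  haveI : Fact (Nat.Prime (m ^ 2 + 4).natAbs) := ⟨hp⟩
  exact blindCurve_bsdTwo_iff_halfUnit (natAbs_sq_add_four_cast m) hm (blindFamilyTorsionLaw_holds m hm h3 hp)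
    _ (not_two_dvd_blindTamagawaCofactor m) (blindFamilyTamagawaLaw_holds m hm hp)

/-- **CUSP CRITERION per member, local terms discharged**: given `BSD₂(E′_m)`, a lattice-optimal datum `D` with the
`L`-link has ODD Manin constant iff `{∞,0}_f` is a half-unit multiple of `Ω⁺_f`. [cite: CremonaAlgorithms1997, §2.8] -/
theorem blindCurve_maninOdd_iff_cuspHalf_of_bsdTwo' {m : ℤ} (hm : Odd m) (h3 : 3 ≤ |m|)
    (hp : Nat.Prime (m ^ 2 + 4).natAbs) [Finite (blindCurve m).sha] (hbsd : BSDTwoAdicLead (blindCurve m))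
    {N : ℕ} [NeZero N] (D : ModularParametrizationData (blindCurve m) N)
    (hopt : ∀ z ∈ D.L.lattice, ∃ w ∈ periodLattice D.f, z = D.c * w)
    (hlink : (blindCurve m).leadingLCoeff = modularSymbol D.f 0) :
    ¬ (2 : ℤ) ∣ D.c ↔
      ∃ a b : ℕ, ¬ 2 ∣ a ∧ ¬ 2 ∣ b ∧ 2 * (b : ℂ) * modularSymbol D.f 0 = (a : ℂ) * (plusPeriod D.f : ℂ) := by
  haveI : Fact (Nat.Prime (m ^ 2 + 4).natAbs) := ⟨hp⟩
  exact blindCurve_maninOdd_iff_cuspHalf_of_bsdTwo (natAbs_sq_add_four_cast m) hm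
    (blindFamilyTorsionLaw_holds m hm h3 hp) _ (not_two_dvd_blindTamagawaCofactor m)
    (blindFamilyTamagawaLaw_holds m hm hp) hbsd D hopt hlink

/-- **BSD₂(E′_m) from an odd Manin constant and a half-unit cusp symbol**, local terms discharged. [cite: Tate1974, Conjecture 4(b)] -/
theorem blindCurve_bsdTwo_of_maninOdd_of_cuspHalf' {m : ℤ} (hm : Odd m) (h3 : 3 ≤ |m|)
    (hp : Nat.Prime (m ^ 2 + 4).natAbs) [Finite (blindCurve m).sha]
    {N : ℕ} [NeZero N] (D : ModularParametrizationData (blindCurve m) N)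
    (hopt : ∀ z ∈ D.L.lattice, ∃ w ∈ periodLattice D.f, z = D.c * w)
    (hlink : (blindCurve m).leadingLCoeff = modularSymbol D.f 0) (hodd : ¬ (2 : ℤ) ∣ D.c)
    (hα : ∃ a b : ℕ, ¬ 2 ∣ a ∧ ¬ 2 ∣ b ∧ 2 * (b : ℂ) * modularSymbol D.f 0 = (a : ℂ) * (plusPeriod D.f : ℂ)) :
    BSDTwoAdicLead (blindCurve m) := by
  haveI : Fact (Nat.Prime (m ^ 2 + 4).natAbs) := ⟨hp⟩
  exact blindCurve_bsdTwo_of_maninOdd_of_cuspHalf (natAbs_sq_add_four_cast m) hm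
    (blindFamilyTorsionLaw_holds m hm h3 hp) _ (not_two_dvd_blindTamagawaCofactor m)
    (blindFamilyTamagawaLaw_holds m hm hp) D hopt hlink hodd hα

/-- **FAMILY-LEVEL CUSP CRITERION under E-an-102 ALONE** (Mazur–Tate–Teitelbaum form): for every member `E′_m`
(`|m| ≥ 3`, `L(E′_m,1) ≠ 0`, `Ш` finite) and every `X₀`-optimal datum `D`, the Manin constant is ODD iff `v₂([0]⁺_f) = −1`
— an's `blindFamily_maninOdd_iff_ratPlusSymbol` with E-an-103 discharged by `blindFamilyLocalTerms_holds`.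
[cite: MazurTateTeitelbaum1986, §I.8] -/
theorem blindFamily_maninOdd_iff_ratPlusSymbol' (hB : BlindFamilyBSDTwo)
    (n : ℤ) (hn : Odd n) (h3 : 3 ≤ |n|) (hprime : Nat.Prime (n ^ 2 + 4).natAbs)
    (hfin : Finite (blindCurve n).sha) (han : (blindCurve n).analyticRank = 0)
    {N : ℕ} [NeZero N] (D : ModularParametrizationData (blindCurve n) N)
    (hopt : ∀ z ∈ D.L.lattice, ∃ w ∈ periodLattice D.f, z = D.c * w) :
    ¬ (2 : ℤ) ∣ D.c ↔ ∃ a b : ℕ, ¬ 2 ∣ a ∧ ¬ 2 ∣ b ∧ 2 * (b : ℚ) * ratPlusSymbol D.f 0 = a :=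
  blindFamily_maninOdd_iff_ratPlusSymbol hB blindFamilyLocalTerms_holds n hn h3 hprime hfin han D hopt

/-- **FAMILY-LEVEL CUSP CRITERION under E-an-102 ALONE**, period form (`2b·{∞,0}_f = a·Ω⁺_f`). [cite: CremonaAlgorithms1997, §2.8] -/
theorem blindFamily_maninOdd_iff_cuspHalf' (hB : BlindFamilyBSDTwo)
    (n : ℤ) (hn : Odd n) (h3 : 3 ≤ |n|) (hprime : Nat.Prime (n ^ 2 + 4).natAbs)
    (hfin : Finite (blindCurve n).sha) (han : (blindCurve n).analyticRank = 0)
    {N : ℕ} [NeZero N] (D : ModularParametrizationData (blindCurve n) N)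
    (hopt : ∀ z ∈ D.L.lattice, ∃ w ∈ periodLattice D.f, z = D.c * w)
    (hlink : (blindCurve n).leadingLCoeff = modularSymbol D.f 0) :
    ¬ (2 : ℤ) ∣ D.c ↔
      ∃ a b : ℕ, ¬ 2 ∣ a ∧ ¬ 2 ∣ b ∧ 2 * (b : ℂ) * modularSymbol D.f 0 = (a : ℂ) * (plusPeriod D.f : ℂ) :=
  blindFamily_maninOdd_iff_cuspHalf hB blindFamilyLocalTerms_holds n hn h3 hprime hfin han D hopt hlink

end Summit.BirchSwinnertonDyer.BirchSwinnertonDyer.Theorems.ManinLocalTwoThree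

end
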